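import Literature.NumberTheory.EllipticCurves.HeegnerPointsShimuraReciprocity
import Literature.NumberTheory.EllipticCurves.HeegnerPointsConjugationClassProofs
import Literature.NumberTheory.EllipticCurves.ComplexMultiplicationClassPolynomialIrreducibleProofs
import HarnessLib

/-!
# Shimura reciprocity for Heegner points: consequences (THEOREMS ONLY)
# — `H.reps ≃ Cl(𝒪_{d_K})`, the old CM fact `heegnerPoints_galoisConj`, and Gross 1991 Prop. 5.3 with `σ'` identified

Topic `NumberTheory/EllipticCurves`. Cell `bsd-goldfeld`, typer seat `bsd-goldfeld-ty` (gen 12); companion of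
the named fact `Literature.NumberTheory.EllipticCurves.heegnerPoints_shimuraReciprocity`
(`HeegnerPointsShimuraReciprocity.lean`, Darmon 2004 Thms. 3.3/3.6/3.7) and of
`HeegnerPointsConjugationClassProofs.lean` ((a1) the pointwise reflection law, (a2) the class of the partner form,
injectivity of `Q ↦ [𝔞_Q]` on representatives). No definition, no named fact (D-0026).

* §1 The class map `heegnerFormClass hK Q = [𝔞_Q] ∈ Cl(𝒪_{d_K})` on Heegner forms: `Γ₀(N)`-equivalent forms have
  the same class (`heegnerFormClass_eq_of_isGamma0Equiv`: `Γ₀(N) ≤ SL₂(ℤ)` and Cox Thm. 7.7 (ii)); injective on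
  `H.reps` (`heegnerFormClass_injOn_reps`); the level form `(N, β, (β² − d_K)/4N)` is a Heegner form, so
  `H.reps ≠ ∅` (`levelForm_mem_heegnerForms`, `HeegnerDatum.reps_nonempty`); the class `[𝔫] = [𝔞_{(N, B, AC/N)}]`
  does not depend on the representative (`heegnerFormClass_levelForm_eq`) and is a SQUARE when `N = n²`
  (`heegnerFormClass_levelForm_eq_sq`: `𝔫 = 𝔮²`, `𝔮` of index `n`).
* §2 Under the fact: `Q ↦ [𝔞_Q]` is a BIJECTION `H.reps → Cl(𝒪_{d_K})`
  (`heegnerPoints_shimuraReciprocity.heegnerFormClass_bijective`; Gross 1984 §I.1); the fact IMPLIES the tree's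
  CM fact `heegnerPoints_galoisConj N W K` with `L = H_K` (`heegnerPoints_galoisConj_of_shimuraReciprocity`) and
  hence leaf 4 `heegnerPointComplex_mem_range_map N W K` of `exists_isHeegnerPoint`
  (`heegnerPointComplex_mem_range_map_of_shimuraReciprocity`); and **Gross 1991, Prop. 5.3 with `σ'`
  identified** (`heegnerPoints_shimuraReciprocity.conj_eq`): for every `q ∈ H.reps` the representative `q*` of
  the partner form `(CN, B, A/N)` has `[𝔞_{q*}] = [𝔫][𝔞_q]⁻¹`, `P_{q*} = θ([𝔫][𝔞_q]⁻²) P_q`, and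
  `conj P_q = ε P_{q*} − ε φ(0)` in `E(ℂ)` — so `σ'_q = θ([𝔫][𝔞_q]⁻²)`, a square of `Gal(H_K/K)` whenever `[𝔫]`
  is a square class (e.g. `N = 49`, `𝔫 = 𝔮₇²`): the input of the half-trace arguments of seats c201
  (`X049GenusHalfTraceFiveModEight`) and c3 on route `GoldfeldAllTwistsTwoConverse`.

## References

* [Darmon2004] H. Darmon, *Rational Points on Modular Elliptic Curves*, CBMS 101 (2004): Thm. 3.3, Thm. 3.6,
  Thm. 3.7 (PDF pp. 41–44), Prop. 3.11 (PDF p. 46), §3.7 (PDF p. 49) (held `paper:doi-10-1090-cbms-101`).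
* [GrossLMS1991] B. H. Gross, *Kolyvagin's work on modular elliptic curves*, LMS LNS 153 (1991), Prop. 5.3 and
  proof (held volume `book:editornd-l-functions-arithmetic`, PDF p. 220).
* [Gross1984] B. H. Gross, *Heegner points on `X₀(N)`* (1984), §I.1, §§4–5 (not held; cited through the above).
* [Cox2013] D. A. Cox, *Primes of the form x² + ny²*, 2nd ed. (2013), §2.A, §7.B Thm. 7.7.
-/

noncomputable section

open scoped Classical MatrixGroups

open Literature.NumberTheory.EllipticCurves.ModularForms NumberField CongruenceSubgroup
open Literature.Computability.Cryptography.Hallgren2005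
open Literature.Computability.Cryptography.Hallgren2005.OrderCl
open Literature.NumberTheory.QuadraticFields.Quadratic

universe u

namespace Literature.NumberTheory.EllipticCurves

/-! ### §1 The class map `heegnerFormClass` on Heegner forms: `Γ₀(N)`-invariance, injectivity on representatives,
the level class -/

section ClassMap

variable {K : Type u} [Field K] [NumberField K] {N : ℕ}

/-- A Heegner form of level `N` and discriminant `d_K` is a primitive positive definite `BinQF` of discriminant
`d_K = (hK.negDiscr).D`. [folklore] -/
private theorem isPosPrim_of_mem (hK : IsImaginaryQuadratic K) {Q : ℤ × ℤ × ℤ}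
    (hQ : Q ∈ heegnerForms N (NumberField.discr K)) :
    (⟨Q.1, Q.2.1, Q.2.2⟩ : BinQF).IsPosPrim hK.negDiscr.D :=
  ⟨hQ.1, hQ.2.1, (BinQF.isPrimitive_iff _).mpr hQ.2.2.2⟩

/-- **`Γ₀(N)`-equivalent Heegner forms have the same class** `[𝔞_Q] ∈ Cl(𝒪_{d_K})`: `Γ₀(N) ≤ SL₂(ℤ)`, and
`SL₂(ℤ)`-equivalent CM points are properly equivalent forms (`properEquiv_of_isGamma0Equiv_one`), which have the
same class (Cox Thm. 7.7 (ii), `classOf'_eq_classOf'_iff_properEquiv`). [cite: Cox2013, §7.B Thm. 7.7] -/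
theorem heegnerFormClass_eq_of_isGamma0Equiv (hK : IsImaginaryQuadratic K) {Q Q' : ℤ × ℤ × ℤ}
    (hQ : Q ∈ heegnerForms N (NumberField.discr K)) (hQ' : Q' ∈ heegnerForms N (NumberField.discr K))
    (h : IsGamma0Equiv N Q Q') : heegnerFormClass hK Q = heegnerFormClass hK Q' := by
  obtain ⟨γ, hγ⟩ := h
  have h1 : IsGamma0Equiv 1 Q Q' :=
    ⟨⟨(γ : SL(2, ℤ)), by rw [CongruenceSubgroup.Gamma0_mem]; exact Subsingleton.elim _ _⟩, hγ⟩
  have hD : Q.2.1 ^ 2 - 4 * Q.1 * Q.2.2 < 0 := hQ.1 ▸ hK.discr_neg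
  have hpe := properEquiv_of_isGamma0Equiv_one hQ.2.1 hD hQ'.2.1 (by rw [hQ.1, hQ'.1]) h1
  exact (classOf'_eq_classOf'_iff_properEquiv hK.negDiscr (isPosPrim_of_mem hK hQ)
    (isPosPrim_of_mem hK hQ')).mpr hpe

/-- **`Q ↦ [𝔞_Q]` is injective on the representatives of a Heegner datum** (`classOf'_injOn_reps` in the
`heegnerFormClass` spelling; Gross 1984 §I.1). [cite: Gross1984, §I.1] -/
theorem heegnerFormClass_injOn_reps (hK : IsImaginaryQuadratic K) (H : HeegnerDatum N (NumberField.discr K))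
    {Q Q' : ℤ × ℤ × ℤ} (hQ : Q ∈ H.reps) (hQ' : Q' ∈ H.reps)
    (h : heegnerFormClass hK Q = heegnerFormClass hK Q') : Q = Q' :=
  classOf'_injOn_reps hK H hQ hQ' h

/-- The same on the subtype `H.reps`. [cite: Gross1984, §I.1] -/
theorem heegnerFormClass_injective_reps (hK : IsImaginaryQuadratic K)
    (H : HeegnerDatum N (NumberField.discr K)) :
    Function.Injective fun q : H.reps ↦ heegnerFormClass hK q :=
  fun q q' h ↦ Subtype.ext (heegnerFormClass_injOn_reps hK H q.2 q'.2 h)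

/-- **The form `(N, β, (β² − d_K)/(4N))` of the level ideal `𝔫`** is a Heegner form of level `N` and discriminant
`d_K` with `B = β`, as soon as no prime factor of `N` divides `d_K` (Gross 1984 §I.1: the point
`(𝒪_K, 𝔫, [𝔫])`; it shows `H.reps ≠ ∅`). [cite: Gross1984, §I.1] -/
theorem levelForm_mem_heegnerForms [NeZero N] (hND : ∀ p : ℕ, p.Prime → p ∣ N → ¬ (p : ℤ) ∣ NumberField.discr K)
    (H : HeegnerDatum N (NumberField.discr K)) :
    ((N : ℤ), H.β, (H.β ^ 2 - NumberField.discr K) / (4 * N)) ∈ heegnerForms N (NumberField.discr K) := by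
  have hN0 : (0 : ℤ) < N := by exact_mod_cast NeZero.pos N
  obtain ⟨c, hc⟩ := H.dvd_sq_sub
  have hC : (H.β ^ 2 - NumberField.discr K) / (4 * N) = c := by
    rw [hc]; exact Int.mul_ediv_cancel_left _ (by positivity)
  refine ⟨?_, hN0, dvd_rfl, ?_⟩
  · show H.β ^ 2 - 4 * (N : ℤ) * ((H.β ^ 2 - NumberField.discr K) / (4 * N)) = NumberField.discr K
    rw [hC]; linarith
  · intro d hdN hdB _
    by_contra hd
    obtain ⟨p, hp, hpd⟩ := Int.exists_prime_and_dvd (fun h ↦ hd (Int.isUnit_iff_natAbs_eq.mpr h))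
    have hq_prime : p.natAbs.Prime := Int.prime_iff_natAbs_prime.mp hp
    have hqp : (p.natAbs : ℤ) ∣ p := Int.natAbs_dvd.mpr dvd_rfl
    have hqN : (p.natAbs : ℤ) ∣ (N : ℤ) := hqp.trans (hpd.trans hdN)
    have hqB : (p.natAbs : ℤ) ∣ H.β := hqp.trans (hpd.trans hdB)
    refine hND p.natAbs hq_prime (Int.natCast_dvd_natCast.mp hqN) ?_
    have : NumberField.discr K = H.β ^ 2 - 4 * N * c := by linarith
    rw [this]
    exact dvd_sub (dvd_pow hqB two_ne_zero) (dvd_mul_of_dvd_left (dvd_mul_of_dvd_right hqN 4) _)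

/-- Under the Heegner hypothesis a Heegner datum has a representative (`levelForm_mem_heegnerForms` and
`HeegnerDatum.exists_isGamma0Equiv`). [cite: Gross1984, §I.1] -/
theorem HeegnerDatum.reps_nonempty [NeZero N] (hK : IsImaginaryQuadratic K) (hH : SatisfiesHeegnerHypothesis N K)
    (H : HeegnerDatum N (NumberField.discr K)) : H.reps.Nonempty := by
  obtain ⟨Q, hQ, -⟩ := H.exists_isGamma0Equiv _
    (levelForm_mem_heegnerForms (fun p hp hpN ↦ not_dvd_discr_of_satisfiesHeegnerHypothesis hK hH hp hpN) H)
    (Int.ModEq.refl _)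
  exact ⟨Q, hQ⟩

/-- **The class `[𝔫]` of the level ideal does not depend on the representative**: for `Q, Q' ∈ H.reps` the forms
`𝔫_Q = (N, B, AC/N)` and `𝔫_{Q'} = (N, B', A'C'/N)` are translates of each other (`B ≡ B' ≡ β (mod 2N)`), hence
properly equivalent with the same class. [cite: Cox2013, §2.A (proper equivalence by T^k)] -/
theorem heegnerFormClass_levelForm_eq [NeZero N] (hK : IsImaginaryQuadratic K)
    (hND : ∀ p : ℕ, p.Prime → p ∣ N → ¬ (p : ℤ) ∣ NumberField.discr K)
    (H : HeegnerDatum N (NumberField.discr K)) {Q Q' : ℤ × ℤ × ℤ} (hQ : Q ∈ H.reps) (hQ' : Q' ∈ H.reps) :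
    heegnerFormClass hK ((N : ℤ), Q.2.1, Q.1 / N * Q.2.2) =
      heegnerFormClass hK ((N : ℤ), Q'.2.1, Q'.1 / N * Q'.2.2) := by
  obtain ⟨hQf, hβ⟩ := H.mem_heegnerForms Q hQ
  obtain ⟨hQf', hβ'⟩ := H.mem_heegnerForms Q' hQ'
  have hn := isPosPrim_levelForm hK.negDiscr hND hQf
  have hn' := isPosPrim_levelForm hK.negDiscr hND hQf'
  -- `B' = B + 2Nk`
  obtain ⟨k, hk⟩ : ∃ k : ℤ, Q'.2.1 = Q.2.1 + 2 * N * k := by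
    obtain ⟨k, hk⟩ := Int.modEq_iff_dvd.mp (hβ.trans hβ'.symm)
    exact ⟨k, by linarith⟩
  have hN0 : (N : ℤ) ≠ 0 := by exact_mod_cast NeZero.ne N
  -- the translate `T^k` of `𝔫_Q` is `𝔫_{Q'}`: same `a = N`, `b' = b + 2Nk`, and then the same `c` (same discriminant)
  have hT := BinQF.properEquiv_T (⟨(N : ℤ), Q.2.1, Q.1 / N * Q.2.2⟩ : BinQF) k
  have h3 := (hT.isPosPrim hK.negDiscr.neg hn).disc_eq
  have h2 := hn'.disc_eq
  simp only [BinQF.disc] at h2 h3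
  have hc : Q'.1 / N * Q'.2.2 = (N : ℤ) * k ^ 2 + Q.2.1 * k + Q.1 / N * Q.2.2 := by
    apply mul_left_cancel₀ (show (4 : ℤ) * N ≠ 0 by positivity)
    rw [hk] at h2
    linarith
  have hform : (⟨(N : ℤ), Q'.2.1, Q'.1 / N * Q'.2.2⟩ : BinQF) =
      ⟨(N : ℤ), Q.2.1 + 2 * (N : ℤ) * k, (N : ℤ) * k ^ 2 + Q.2.1 * k + Q.1 / N * Q.2.2⟩ :=
    BinQF.ext rfl hk hc
  have hpe : (⟨(N : ℤ), Q.2.1, Q.1 / N * Q.2.2⟩ : BinQF).ProperEquiv ⟨(N : ℤ), Q'.2.1, Q'.1 / N * Q'.2.2⟩ := by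
    rw [hform]; exact hT
  exact (classOf'_eq_classOf'_iff_properEquiv hK.negDiscr hn hn').mpr hpe

/-- If `d ∣ N` and `d ∣ B` for a Heegner form `(A, B, C)` of level `N` and discriminant `d_K` with `gcd(N, d_K) = 1`,
then `d` is a unit (a common prime factor would divide `d_K = B² − 4AC`). [folklore] -/
private theorem isUnit_of_dvd_level' (hND : ∀ p : ℕ, p.Prime → p ∣ N → ¬ (p : ℤ) ∣ NumberField.discr K)
    {Q : ℤ × ℤ × ℤ} (hQ : Q ∈ heegnerForms N (NumberField.discr K)) {d : ℤ} (hdN : d ∣ (N : ℤ))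
    (hdB : d ∣ Q.2.1) : IsUnit d := by
  obtain ⟨hdisc, -, hNA, -⟩ := hQ
  by_contra hd
  obtain ⟨p, hp, hpd⟩ := Int.exists_prime_and_dvd (fun h ↦ hd (Int.isUnit_iff_natAbs_eq.mpr h))
  have hq_prime : p.natAbs.Prime := Int.prime_iff_natAbs_prime.mp hp
  have hqp : (p.natAbs : ℤ) ∣ p := Int.natAbs_dvd.mpr dvd_rfl
  have hqN : (p.natAbs : ℤ) ∣ (N : ℤ) := hqp.trans (hpd.trans hdN)
  have hqB : (p.natAbs : ℤ) ∣ Q.2.1 := hqp.trans (hpd.trans hdB)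
  refine hND p.natAbs hq_prime (Int.natCast_dvd_natCast.mp hqN) ?_
  rw [← hdisc]
  exact dvd_sub (dvd_pow hqB two_ne_zero) (dvd_mul_of_dvd_left (dvd_mul_of_dvd_right (hqN.trans hNA) 4) _)

/-- **For a square level `N = n²` the class `[𝔫]` is a square**: `𝔫 = 𝔮²` with `𝔮 = (n, (−B + √d_K)/2)` the ideal of
index `n` — in forms, `[𝔞_{(n², B, AC/n²)}] = [𝔞_{(n, B, n·AC/n²)}]²` (the concordant composition
`classOf'_eq_mul_levelForm` at level `n` applied to the form `(n², B, AC/n²)`). This is why Gross's `σ' = θ([𝔫][𝔞_q]⁻²)`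
is a square of `Gal(H_K/K)` on `X₀(49)` (`𝔫 = 𝔮₇²`), the input of the half-trace arguments.
[cite: Gross1984, §I.1 (the ideal 𝔫)] [cite: Cox2013, §3.A Lemma 3.2 / (3.7) with §7.B Thm. 7.7] -/
theorem heegnerFormClass_levelForm_eq_sq {n : ℕ} [NeZero n] (hK : IsImaginaryQuadratic K) (hN : N = n ^ 2)
    (hND : ∀ p : ℕ, p.Prime → p ∣ N → ¬ (p : ℤ) ∣ NumberField.discr K) {Q : ℤ × ℤ × ℤ}
    (hQ : Q ∈ heegnerForms N (NumberField.discr K)) :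
    heegnerFormClass hK ((N : ℤ), Q.2.1, Q.1 / N * Q.2.2) =
      heegnerFormClass hK ((n : ℤ), Q.2.1, (n : ℤ) * (Q.1 / N * Q.2.2)) ^ 2 := by
  haveI : NeZero N := ⟨by rw [hN]; exact pow_ne_zero 2 (NeZero.ne n)⟩
  obtain ⟨hdisc, hA, hNA, hprim⟩ := hQ
  have hNn : (N : ℤ) = (n : ℤ) ^ 2 := by exact_mod_cast hN
  have hn0 : (n : ℤ) ≠ 0 := by exact_mod_cast NeZero.ne n
  have hNDn : ∀ p : ℕ, p.Prime → p ∣ n → ¬ (p : ℤ) ∣ NumberField.discr K :=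
    fun p hp hpn ↦ hND p hp (hN ▸ dvd_pow hpn two_ne_zero)
  -- the form `(n², B, AC/N)` is a Heegner form of level `n`
  have hQ₂ : (((n : ℤ) ^ 2, Q.2.1, Q.1 / N * Q.2.2) : ℤ × ℤ × ℤ) ∈ heegnerForms n (NumberField.discr K) := by
    refine ⟨?_, by positivity, dvd_pow_self _ two_ne_zero, ?_⟩
    · show Q.2.1 ^ 2 - 4 * (n : ℤ) ^ 2 * (Q.1 / N * Q.2.2) = NumberField.discr K
      rw [← hdisc, ← hNn, show 4 * (N : ℤ) * (Q.1 / N * Q.2.2) = 4 * (Q.1 / N * N) * Q.2.2 by ring,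
        Int.ediv_mul_cancel hNA]
    · intro d hdn hdB _
      exact isUnit_of_dvd_level' hND ⟨hdisc, hA, hNA, hprim⟩ (hNn ▸ hdn) hdB
  have h := classOf'_eq_mul_levelForm hK.negDiscr (N := n) hNDn hQ₂
  -- `n²/n = n`
  have hdiv : (n : ℤ) ^ 2 / (n : ℤ) = n := by rw [sq, Int.mul_ediv_cancel _ hn0]
  simp only [hdiv] at h
  rw [heegnerFormClass, heegnerFormClass, sq, show ((N : ℤ), Q.2.1, Q.1 / ↑N * Q.2.2).1 = (n : ℤ) ^ 2 from hNn]
  convert h using 3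
  simp only [mul_comm]

end ClassMap

/-! ### §2 Consequences of the fact: the bijection `H.reps ≃ Cl(𝒪_{d_K})`, the old CM fact, and Gross's
Prop. 5.3 with `σ'` identified -/

section Consequences

variable {N : ℕ} [NeZero N] {W : WeierstrassCurve ℚ} {K : Type u} [Field K] [NumberField K]

/-- **`H.reps ≃ Cl(𝒪_{d_K})` under Shimura reciprocity**: the class map on representatives is injective (tree,
`heegnerFormClass_injective_reps`) and — by the transport law `∀ γ q, ∃ q', [𝔞_{q'}] = γ[𝔞_q]` of the fact and
`H.reps ≠ ∅` — surjective (Gross 1984 §I.1: the Heegner points with fixed `𝔫` form one simply transitive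
`Pic(𝒪_K)`-orbit). [cite: Gross1984, §I.1] [cite: Darmon2004, Thm. 3.7] -/
theorem heegnerPoints_shimuraReciprocity.heegnerFormClass_bijective
    (h : heegnerPoints_shimuraReciprocity N W K) [W.IsElliptic] (hK : IsImaginaryQuadratic K)
    (hH : SatisfiesHeegnerHypothesis N K) (Dt : ModularParametrizationData W N)
    (H : HeegnerDatum N (NumberField.discr K)) (ι : K →+* ℂ) :
    Function.Bijective fun q : H.reps ↦ heegnerFormClass hK q := by
  refine ⟨heegnerFormClass_injective_reps hK H, fun γ ↦ ?_⟩
  obtain ⟨q₀, hq₀⟩ := HeegnerDatum.reps_nonempty hK hH H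
  obtain ⟨P, θ, -, hθ⟩ := h hK hH Dt H ι
  obtain ⟨q', hq', -⟩ := hθ (γ * (heegnerFormClass hK q₀)⁻¹) ⟨q₀, hq₀⟩
  exact ⟨q', by simp only [hq', inv_mul_cancel_right]⟩

/-- **The new fact implies the tree's CM fact `heegnerPoints_galoisConj`** (with `L = H_K`, the field of singular
moduli; `j` the inclusion `H_K ⊂ ℂ`): `H_K/K` is finite Galois and a number field
(`finiteDimensional_and_isGalois_singularModuliField`, `numberField_singularModuliField`, from the tree's theorem
`irreducible_classPolynomial_holds`), the lifts `P_Q` are those of the fact, and each `σ ∈ Gal(H_K/K)` PERMUTES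
them: `σ P_Q = P_{Q'}` with `[𝔞_{Q'}] = θ⁻¹(σ)[𝔞_Q]`, a bijection of `H.reps` because `Q ↦ [𝔞_Q]` is injective.
Hence also leaf 4 `heegnerPointComplex_mem_range_map N W K` (`heegnerPointComplex_mem_range_map_of_galoisConj`).
[cite: Darmon2004, Thm. 3.6 and Thm. 3.7 (PDF pp. 43–44)] -/
theorem heegnerPoints_galoisConj_of_shimuraReciprocity (h : heegnerPoints_shimuraReciprocity N W K) :
    heegnerPoints_galoisConj N W K := by
  intro _ hK hH Dt H ι
  obtain ⟨P, θ, hP, hθ⟩ := h hK hH Dt H ι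
  obtain ⟨-, hgal⟩ := finiteDimensional_and_isGalois_singularModuliField irreducible_classPolynomial_holds hK ι
  haveI := numberField_singularModuliField irreducible_classPolynomial_holds hK ι
  refine ⟨singularModuliField K ι, inferInstance, inferInstance, inferInstance, hgal,
    (singularModuliField K ι).subtype, P, subtype_comp_algebraMap_singularModuliField ι, hP, fun σ ↦ ?_⟩
  choose e he using fun q : H.reps ↦ hθ (θ.symm σ) q
  have hinj : Function.Injective e := fun q₁ q₂ heq ↦ by
    have h₁ := (he q₁).1
    have h₂ := (he q₂).1
    rw [heq] at h₁
    exact heegnerFormClass_injective_reps hK H (mul_left_cancel (h₁.symm.trans h₂))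
  refine ⟨Equiv.ofBijective e ((Fintype.bijective_iff_injective_and_card e).mpr ⟨hinj, rfl⟩), fun q ↦ ?_⟩
  have h2 := (he q).2
  rw [MulEquiv.apply_symm_apply] at h2
  exact h2

/-- **Leaf 4 of `exists_isHeegnerPoint` from the new fact**: the traced Heegner point is `K`-rational.
[cite: Darmon2004, §3.7 (PDF p. 49)] -/
theorem heegnerPointComplex_mem_range_map_of_shimuraReciprocity (h : heegnerPoints_shimuraReciprocity N W K) :
    heegnerPointComplex_mem_range_map N W K :=
  heegnerPointComplex_mem_range_map_of_galoisConj (heegnerPoints_galoisConj_of_shimuraReciprocity h)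

/-- **Gross 1991, Prop. 5.3 with `σ'` IDENTIFIED, for every representative** ("`y^τ = ε · y^{σ'} + (torsion)` for some
`σ' ∈ 𝒢`", proof: "`x^τ = w_N(x^{σ'})`, … `(x − ∞)^τ = w_N (x − ∞)^{σ'} + (w_N∞ − ∞)`"): under Shimura reciprocity,
for the family `P` and the isomorphism `θ` of the fact and every `q ∈ H.reps`, the representative `q*` of the
partner form `(CN, B, A/N)` satisfies `[𝔞_{q*}] = [𝔫]·[𝔞_q]⁻¹` (§2 of the companion, `classOf'_negB_fricke`),
`P_{q*} = θ([𝔫][𝔞_q]⁻²) P_q` (the transport law; so `σ'_q = θ([𝔫][𝔞_q]⁻²)`, a SQUARE of `Gal(H_K/K)` whenever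
`[𝔫]` is a square class, e.g. `N` a perfect square), and in `E(ℂ)`
`conj P_q = ε P_{q*} − ε φ(0)` (`conjPoint_φ_heegnerTau`; `φ(0)` the rational torsion image of the cusp `0`,
`ε = ±1` the Fricke eigenvalue, `w(E) = −ε`). Here `[𝔫] = [𝔞_{(N, B, AC/N)}]` (`heegnerFormClass_levelForm_eq`:
independent of `q`). [cite: GrossLMS1991, Prop. 5.3 and proof (PDF p. 220)] [cite: Darmon2004, Thm. 3.7 and Prop. 3.11] -/
theorem heegnerPoints_shimuraReciprocity.conj_eq (h : heegnerPoints_shimuraReciprocity N W K) [W.IsElliptic]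
    (hK : IsImaginaryQuadratic K) (hH : SatisfiesHeegnerHypothesis N K) (Dt : ModularParametrizationData W N)
    (H : HeegnerDatum N (NumberField.discr K)) (ι : K →+* ℂ) {e : ℤ}
    (hW : ModularForms.IsFrickeEigen N Dt.f (e : ℂ)) (he : e = 1 ∨ e = -1) :
    ∃ (P : H.reps → (W.baseChange (singularModuliField K ι)).toAffine.Point)
      (θ : ClassGroup (OrderCl.QO hK.negDiscr) ≃*
        (singularModuliField K ι ≃ₐ[K] singularModuliField K ι)),
      (∀ q : H.reps,
        WeierstrassCurve.Affine.Point.map (singularModuliField K ι).subtype.toRatAlgHom (P q) =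
          Dt.φ (heegnerTau q)) ∧
      (∀ (γ : ClassGroup (OrderCl.QO hK.negDiscr)) (q : H.reps), ∃ q' : H.reps,
        heegnerFormClass hK q' = γ * heegnerFormClass hK q ∧
        WeierstrassCurve.Affine.Point.map
          (θ γ : singularModuliField K ι →ₐ[K] singularModuliField K ι) (P q) = P q') ∧
      ∀ q : H.reps, ∃ qs : H.reps,
        heegnerFormClass hK qs =
          heegnerFormClass hK ((N : ℤ), q.1.2.1, q.1.1 / N * q.1.2.2) * (heegnerFormClass hK q)⁻¹ ∧
        WeierstrassCurve.Affine.Point.map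
          (θ (heegnerFormClass hK ((N : ℤ), q.1.2.1, q.1.1 / N * q.1.2.2) * (heegnerFormClass hK q)⁻¹ *
            (heegnerFormClass hK q)⁻¹) : singularModuliField K ι →ₐ[K] singularModuliField K ι) (P q) = P qs ∧
        conjPoint W (WeierstrassCurve.Affine.Point.map (singularModuliField K ι).subtype.toRatAlgHom (P q)) =
          e • WeierstrassCurve.Affine.Point.map (singularModuliField K ι).subtype.toRatAlgHom (P qs) -
            e • Dt.cuspZeroPoint := by
  obtain ⟨P, θ, hP, hθ⟩ := h hK hH Dt H ι
  refine ⟨P, θ, hP, hθ, fun q ↦ ?_⟩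
  have hND : ∀ p : ℕ, p.Prime → p ∣ N → ¬ (p : ℤ) ∣ NumberField.discr K :=
    fun p hp hpN ↦ not_dvd_discr_of_satisfiesHeegnerHypothesis hK hH hp hpN
  obtain ⟨hqf, hβ⟩ := H.mem_heegnerForms q q.2
  -- the representative `qs` of the partner form `(CN, B, A/N)`
  have hstar : HeegnerForm.negB (HeegnerForm.fricke N (q : ℤ × ℤ × ℤ)) ∈ heegnerForms N (NumberField.discr K) :=
    HeegnerForm.negB_mem_heegnerForms (HeegnerForm.fricke_mem_heegnerForms hK.discr_neg hND hqf)
  obtain ⟨qs, hqs, hequiv⟩ := H.exists_isGamma0Equiv _ hstar (by simpa using hβ)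
  -- its class
  have hcl : heegnerFormClass hK qs =
      heegnerFormClass hK ((N : ℤ), q.1.2.1, q.1.1 / N * q.1.2.2) * (heegnerFormClass hK q)⁻¹ := by
    rw [← heegnerFormClass_eq_of_isGamma0Equiv hK hstar (H.mem_heegnerForms qs hqs).1 hequiv]
    exact classOf'_negB_fricke' hK.negDiscr hND hqf
  refine ⟨⟨qs, hqs⟩, hcl, ?_, ?_⟩
  · -- transport: the representative with class `[𝔫][𝔞_q]⁻² · [𝔞_q] = [𝔫][𝔞_q]⁻¹` is `qs`
    obtain ⟨q'', hq'', hmap⟩ := hθ (heegnerFormClass hK ((N : ℤ), q.1.2.1, q.1.1 / N * q.1.2.2) *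
      (heegnerFormClass hK q)⁻¹ * (heegnerFormClass hK q)⁻¹) q
    rw [inv_mul_cancel_right] at hq''
    have : q'' = ⟨qs, hqs⟩ := heegnerFormClass_injective_reps hK H (hq''.trans hcl.symm)
    rw [← this]
    exact hmap
  · -- complex conjugation, in `E(ℂ)`
    rw [hP q, hP ⟨qs, hqs⟩, conjPoint_φ_heegnerTau Dt hW he hK.discr_neg hqf]
    obtain ⟨γ, hγ⟩ := hequiv
    rw [← hγ, Dt.φ_gamma0_smul_holds (ModularForms.eichlerIntegral_gamma_smul_holds Dt.f) γ]

end Consequences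

end Literature.NumberTheory.EllipticCurves

end
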